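import Summits.NavierStokesRegularity.NavierStokesRegularity.Theorems.CoriolisHeadTypeIRateLogRate
import Literature.Analysis.Calculus.DerivativeInterpolation
import HarnessLib

/-!
# CoriolisHeadTypeIRate — crux `NoCoRotatingCore` (stmt-NavierStokesRegularity-22676), line `far_field_constancy` v2
# (skeleton `Cruxes/NoCoRotatingCore/Lines/far_field_constancy.lean` 15c9a82ad206abb9, ns-idea-10 g2): **stub K1c
# `stub_typeIRate` PROVED BY NAME** (seat ns-ffc-k1 g2)

K1c: a bounded smooth div-free rotated Leray profile (`ν, a > 0`, `B` skew) with SCALE-NATURAL DERIVATIVE DECAY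
(K1a: `‖y‖‖DU(y)‖ + ‖y‖²‖D²U(y)‖ → 0`) that tends to `b` at infinity does so AT THE TYPE-I RATE
`‖U(y) − b‖ ≤ K/(1 + ‖y‖)`.

PROOF (the logarithm of the critical resonance is removed by an interpolation bootstrap).
(1) UNCONDITIONAL LOG-LOSS RATE (landed, `TypeIRate.typeIRate_log_of_scaleNaturalDecay`): the registered hypotheses
give `‖U(y) − b‖ ≤ K(1 + log(1 + ‖y‖))/(1 + ‖y‖)`, in particular `≤ 2K/√(1 + ‖y‖)`.
(2) LANDAU–KOLMOGOROV INTERPOLATION on the ball `B(y, ‖y‖/2)` with the step `s = ‖y‖^{3/4}` (tree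
`Literature.Analysis.Calculus.norm_iteratedFDeriv_succ_le_of_bounds`, mean value theorem twice):
`‖DU(y)‖ ≤ 2 sup‖U − b‖/s + s·sup‖D²U‖ ≤ 8K/‖y‖^{5/4} + 4/‖y‖^{5/4}`, using K1a only through `‖D²U(z)‖ ≤ 1/‖z‖²`
far out.  This is a POWER GAIN `‖DU(y)‖ ≤ C₁/‖y‖^{1+δ'}`, `δ' = 1/4`, over K1a's `o(1/‖y‖)`
(`TypeIRate.fderiv_power_decay_of_logRate`).
(3) The landed `TypeIRate.typeIRate_of_fderiv_power_decay` (K1c from exactly such a gradient power gain: the pressure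
Poisson equation `ΔP = −tr(DU∘DU)` then has a super-critically decaying right-hand side, the telescoped
Newtonian-kernel estimate gives a summable rate for `∇P − g`, and the spiral transport integrates it without loss)
concludes `‖U(y) − b‖ ≤ K/(1 + ‖y‖)`.

HONEST FRAMING: K1c is a crux stub of a LINE about hypothetical blow-up profiles; K1a (`stub_scaleNaturalDecay`, the
hard core) and the residual `stub_pineauVicolConjecture` (Pineau–Vicol's Conjecture 1.1 as printed) stay OPEN; nothing
here proves `NoCoRotatingCore`, `SpiralScalingLiouville`, Pineau–Vicol's conjecture or Navier–Stokes regularity.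

References: line card `Cruxes/NoCoRotatingCore/Lines/far_field_constancy.md` (K1c block); B. Pineau, V. Vicol,
arXiv:2607.09619 (2026), (1.8), Conj. 1.1, Prop. 3.1 [PineauVicol2026]; E. Landau, Proc. LMS (2) 13 (1913) 43–49
(interpolation inequality) [folklore].
-/

noncomputable section

open MeasureTheory Set Function Filter Topology Metric InnerProductSpace Real
open scoped RealInnerProductSpace Laplacian ContDiff

-- the summit and its single sub-problem share the name (CONVENTIONS §1), as in every Theorems file
set_option linter.dupNamespace false

namespace Summit.NavierStokesRegularity.NavierStokesRegularity.Theorems.CoriolisHead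

namespace TypeIRate

open Literature.Analysis.FluidPDE

/-! ## §1 Landau's interpolation inequality for `f − b` between the orders 0, 1, 2 -/

section Interpolation

variable {E F : Type*} [NormedAddCommGroup E] [NormedSpace ℝ E] [NormedAddCommGroup F] [NormedSpace ℝ F]

/-- **Landau's inequality on a ball, orders 0/1/2, with a constant subtracted.**  For a smooth `f`, if
`‖f − b‖ ≤ M₀` and `‖D²f‖ ≤ M₂` on `ball p r`, then `‖Df(p)‖ ≤ 2M₀/s + sM₂` for every `0 < s < r`
(tree `Literature.Analysis.Calculus.norm_iteratedFDeriv_succ_le_of_bounds` applied to `f − b`). [folklore] -/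
theorem norm_fderiv_le_of_sub_const_bounds {f : E → F} (hf : ContDiff ℝ ∞ f) {p : E} (b : F)
    {r M₀ M₂ : ℝ} (hM₂ : 0 ≤ M₂) (h0 : ∀ y ∈ ball p r, ‖f y - b‖ ≤ M₀)
    (h2 : ∀ y ∈ ball p r, ‖iteratedFDeriv ℝ 2 f y‖ ≤ M₂) {s : ℝ} (hs : 0 < s) (hsr : s < r) :
    ‖fderiv ℝ f p‖ ≤ 2 * M₀ / s + s * M₂ := by
  set g : E → F := fun y => f y - b with hg
  have hgs : ContDiff ℝ ∞ g := hf.sub contDiff_const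
  have hfd : fderiv ℝ g = fderiv ℝ f := by
    funext y
    exact fderiv_sub_const b
  have h0' : ∀ y ∈ ball p r, ‖iteratedFDeriv ℝ 0 g y‖ ≤ M₀ := fun y hy => by
    rw [norm_iteratedFDeriv_zero]
    exact h0 y hy
  have h2' : ∀ y ∈ ball p r, ‖iteratedFDeriv ℝ (0 + 2) g y‖ ≤ M₂ := fun y hy => by
    show ‖iteratedFDeriv ℝ 2 g y‖ ≤ M₂
    rw [← norm_iteratedFDeriv_fderiv, hfd, norm_iteratedFDeriv_fderiv]
    exact h2 y hy
  have h : ‖iteratedFDeriv ℝ 1 g p‖ ≤ 2 * M₀ / s + s * M₂ :=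
    Literature.Analysis.Calculus.norm_iteratedFDeriv_succ_le_of_bounds hgs hM₂ h0' h2' hs hsr
  rwa [norm_iteratedFDeriv_one, hfd] at h

end Interpolation

/-! ## §2 The gradient power gain from the log-loss rate and K1a -/

/-- `1 + log(1 + x) ≤ 2√(1 + x)` for `x ≥ 0` (`log u² = 2 log u ≤ 2(u − 1)`). [folklore] -/
theorem one_add_log_one_add_le_two_mul_sqrt {x : ℝ} (hx : 0 ≤ x) :
    1 + Real.log (1 + x) ≤ 2 * Real.sqrt (1 + x) := by
  have h1 : 0 < 1 + x := by linarith
  have hs : 0 < Real.sqrt (1 + x) := Real.sqrt_pos.2 h1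
  have hlog : Real.log (1 + x) = 2 * Real.log (Real.sqrt (1 + x)) := by
    rw [Real.log_sqrt h1.le]; ring
  have hle : Real.log (Real.sqrt (1 + x)) ≤ Real.sqrt (1 + x) - 1 := Real.log_le_sub_one_of_pos hs
  rw [hlog]
  linarith

section Profile

variable {U : EuclideanSpace ℝ (Fin 3) → EuclideanSpace ℝ (Fin 3)}

/-- **The gradient power gain.**  If `U` is smooth with K1a (`‖y‖‖DU‖ + ‖y‖²‖D²U‖ → 0`) and obeys the log-loss rate
`‖U(y) − b‖ ≤ K(1 + log(1 + ‖y‖))/(1 + ‖y‖)`, then `‖DU(y)‖ ≤ C₁/‖y‖^{5/4}` far out: Landau's inequality on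
`B(y, ‖y‖/2)` with step `s = ‖y‖^{3/4}` (written with `t = ‖y‖^{1/4}`: `‖y‖ = t⁴`, `s = t³`, `sup‖U − b‖ ≤ 4K/t²`,
`sup‖D²U‖ ≤ 4/t⁸`, so `‖DU(y)‖ ≤ (8K + 4)/t⁵`).  This is hypothesis `hgradU` of `typeIRate_of_fderiv_power_decay`
with `δ' = 1/4`. [folklore] -/
theorem fderiv_power_decay_of_logRate (hU : ContDiff ℝ (⊤ : ℕ∞) U)
    (hdecay : ∀ ε : ℝ, 0 < ε → ∃ R : ℝ, ∀ y : EuclideanSpace ℝ (Fin 3), R ≤ ‖y‖ →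
      ‖y‖ * ‖fderiv ℝ U y‖ + ‖y‖ ^ 2 * ‖iteratedFDeriv ℝ 2 U y‖ ≤ ε)
    {b : EuclideanSpace ℝ (Fin 3)} {K : ℝ}
    (hK : ∀ y : EuclideanSpace ℝ (Fin 3), ‖U y - b‖ ≤ K * (1 + Real.log (1 + ‖y‖)) / (1 + ‖y‖)) :
    ∃ δ' C₁ R₁ : ℝ, 0 < δ' ∧ ∀ y : EuclideanSpace ℝ (Fin 3), R₁ ≤ ‖y‖ →
      ‖fderiv ℝ U y‖ ≤ C₁ / ‖y‖ ^ (1 + δ') := by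
  have hUs : ContDiff ℝ ∞ U := hU
  -- K1a at tolerance `1`
  obtain ⟨R, hR1, hR⟩ := FarFieldLimit.exists_radius_decay hdecay one_pos
  -- `K ≥ 0` (evaluate the log-loss bound at the origin)
  have hK0 : 0 ≤ K := by
    have h := hK 0
    simp only [norm_zero, add_zero, Real.log_one, mul_one, div_one] at h
    exact (norm_nonneg _).trans h
  refine ⟨1 / 4, 8 * K + 4, max (2 * R) 81, by norm_num, fun y hy => ?_⟩
  have hy81 : 81 ≤ ‖y‖ := (le_max_right _ _).trans hy
  have hy2R : 2 * R ≤ ‖y‖ := (le_max_left _ _).trans hy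
  have hypos : 0 < ‖y‖ := by linarith
  -- the fourth root `t` of `‖y‖`
  set t : ℝ := Real.sqrt (Real.sqrt ‖y‖) with ht
  have ht0 : 0 ≤ t := Real.sqrt_nonneg _
  have ht2 : t ^ 2 = Real.sqrt ‖y‖ := Real.sq_sqrt (Real.sqrt_nonneg _)
  have ht4 : ‖y‖ = t ^ 4 := by
    have h : (t ^ 2) ^ 2 = ‖y‖ := by rw [ht2, Real.sq_sqrt (norm_nonneg _)]
    rw [← h]; ring
  have ht3 : 3 ≤ t := by
    have h9 : 9 ≤ Real.sqrt ‖y‖ := by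
      rw [show (9 : ℝ) = Real.sqrt 81 by rw [show (81 : ℝ) = 9 ^ 2 by norm_num, Real.sqrt_sq (by norm_num)]]
      exact Real.sqrt_le_sqrt hy81
    rw [ht, show (3 : ℝ) = Real.sqrt 9 by rw [show (9 : ℝ) = 3 ^ 2 by norm_num, Real.sqrt_sq (by norm_num)]]
    exact Real.sqrt_le_sqrt h9
  have htpos : 0 < t := by linarith
  -- the step `s = t³ < ‖y‖/2`
  have hs : 0 < t ^ 3 := by positivity
  have hsr : t ^ 3 < ‖y‖ / 2 := by
    rw [ht4]
    nlinarith [pow_pos htpos 3]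
  -- bounds on the ball `B(y, ‖y‖/2)`: every point there has norm `> ‖y‖/2 ≥ R`
  have hfar : ∀ z ∈ ball y (‖y‖ / 2), ‖y‖ / 2 < ‖z‖ := fun z hz => by
    rw [mem_ball, dist_eq_norm] at hz
    have h := norm_sub_norm_le y z
    rw [← norm_neg (y - z), neg_sub] at h
    linarith
  have h0 : ∀ z ∈ ball y (‖y‖ / 2), ‖U z - b‖ ≤ 4 * K / t ^ 2 := fun z hz => by
    have hz := hfar z hz
    have hz0 : 0 ≤ ‖z‖ := norm_nonneg _
    have h1z : 0 < 1 + ‖z‖ := by linarith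
    have hsq : 0 < Real.sqrt (1 + ‖z‖) := Real.sqrt_pos.2 h1z
    -- `‖U z − b‖ ≤ 2K/√(1 + ‖z‖)`
    have hstep : ‖U z - b‖ ≤ 2 * K / Real.sqrt (1 + ‖z‖) := by
      refine (hK z).trans ?_
      have hlog := one_add_log_one_add_le_two_mul_sqrt hz0
      have hsq2 : Real.sqrt (1 + ‖z‖) * Real.sqrt (1 + ‖z‖) = 1 + ‖z‖ := Real.mul_self_sqrt h1z.le
      rw [div_le_div_iff₀ h1z hsq]
      calc K * (1 + Real.log (1 + ‖z‖)) * Real.sqrt (1 + ‖z‖)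
          ≤ K * (2 * Real.sqrt (1 + ‖z‖)) * Real.sqrt (1 + ‖z‖) := by gcongr
        _ = 2 * K * (Real.sqrt (1 + ‖z‖) * Real.sqrt (1 + ‖z‖)) := by ring
        _ = 2 * K * (1 + ‖z‖) := by rw [hsq2]
    -- `√(1 + ‖z‖) ≥ t²/2`
    have hroot : t ^ 2 / 2 ≤ Real.sqrt (1 + ‖z‖) := by
      refine Real.le_sqrt_of_sq_le ?_
      rw [ht4] at hz
      nlinarith [sq_nonneg (t ^ 2)]
    have ht2pos : 0 < t ^ 2 / 2 := by positivity
    calc ‖U z - b‖ ≤ 2 * K / Real.sqrt (1 + ‖z‖) := hstep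
      _ ≤ 2 * K / (t ^ 2 / 2) := by gcongr
      _ = 4 * K / t ^ 2 := by field_simp; ring
  have h2 : ∀ z ∈ ball y (‖y‖ / 2), ‖iteratedFDeriv ℝ 2 U z‖ ≤ 4 / t ^ 8 := fun z hz => by
    have hz := hfar z hz
    have hzR : R ≤ ‖z‖ := by linarith
    have hzpos : 0 < ‖z‖ := by linarith
    refine (hR z hzR).2.trans ?_
    rw [div_le_div_iff₀ (pow_pos hzpos 2) (by positivity)]
    rw [ht4] at hz
    nlinarith [pow_pos htpos 4, mul_pos (pow_pos htpos 4) hzpos]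
  -- Landau
  have hL := norm_fderiv_le_of_sub_const_bounds hUs b (by positivity) h0 h2 hs hsr
  -- arithmetic: `2(4K/t²)/t³ + t³·4/t⁸ = (8K + 4)/t⁵ = (8K + 4)/‖y‖^{5/4}`
  have hpow : ‖y‖ ^ ((1 : ℝ) + 1 / 4) = t ^ 5 := by
    rw [ht4, ← Real.rpow_natCast t 4, ← Real.rpow_mul ht0]
    norm_num
  rw [hpow]
  have ht5 : 0 < t ^ 5 := pow_pos htpos 5
  calc ‖fderiv ℝ U y‖ ≤ 2 * (4 * K / t ^ 2) / t ^ 3 + t ^ 3 * (4 / t ^ 8) := hL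
    _ = (8 * K + 4) / t ^ 5 := by field_simp; ring

end Profile

end TypeIRate

/-! ## §3 Stub K1c by name -/

-- the skeleton of record states the stub with this local notation; the header below is its text verbatim
local notation "E3" => EuclideanSpace ℝ (Fin 3)

/-- **stub K1c — `stub_typeIRate`** of the line `far_field_constancy` (crux `CoriolisHead.NoCoRotatingCore`, item
22676), statement VERBATIM from the skeleton of record: a bounded smooth div-free rotated Leray profile with scale-natural
derivative decay (K1a) that tends to `b` at infinity does so at the Type-I rate `‖U(y) − b‖ ≤ K/(1 + ‖y‖)`.
Proof: the landed log-loss rate (`TypeIRate.typeIRate_log_of_scaleNaturalDecay`), the interpolation power gain on the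
gradient (`TypeIRate.fderiv_power_decay_of_logRate`), and the landed K1c-from-power-gain theorem
(`TypeIRate.typeIRate_of_fderiv_power_decay`); see the module docstring.  K1a, the Pineau–Vicol residual,
`NoCoRotatingCore` and NS regularity are NOT proved here. [cite: PineauVicol2026, Conj. 1.1, Prop. 3.1] -/
theorem stub_typeIRate :
    ∀ (ν a : ℝ), 0 < ν → 0 < a → ∀ (B : E3 →L[ℝ] E3) (U : E3 → E3) (P : E3 → ℝ),
      ContDiff ℝ (⊤ : ℕ∞) U → ContDiff ℝ 2 P → (∀ x, inner ℝ (B x) x = 0) →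
      Literature.Analysis.FluidPDE.VectorCalculus.IsDivFree U →
      (∀ y, -(ν • Laplacian.laplacian U y) + a • U y + a • fderiv ℝ U y y
        + (B (U y) - fderiv ℝ U y (B y)) + Literature.Analysis.FluidPDE.convect U U y
        + gradient P y = 0) →
      (∃ M : ℝ, ∀ y, ‖U y‖ ≤ M) →
      (∀ ε : ℝ, 0 < ε → ∃ R : ℝ, ∀ y, R ≤ ‖y‖ →
        ‖y‖ * ‖fderiv ℝ U y‖ + ‖y‖ ^ 2 * ‖iteratedFDeriv ℝ 2 U y‖ ≤ ε) →
      ∀ b : E3, (∀ ε : ℝ, 0 < ε → ∃ R : ℝ, ∀ y, R ≤ ‖y‖ → ‖U y - b‖ ≤ ε) →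
      ∃ K : ℝ, ∀ y, ‖U y - b‖ ≤ K / (1 + ‖y‖) := by
  intro ν a hν ha B U P hU hP hB hdiv heq hbdd hdecay b hlim
  obtain ⟨K, hK⟩ :=
    TypeIRate.typeIRate_log_of_scaleNaturalDecay hν ha hB hU hP hdiv heq hbdd hdecay b hlim
  exact TypeIRate.typeIRate_of_fderiv_power_decay hν ha hB hU hP hdiv heq hbdd hdecay b hlim
    (TypeIRate.fderiv_power_decay_of_logRate hU hdecay hK)

end Summit.NavierStokesRegularity.NavierStokesRegularity.Theorems.CoriolisHead

end
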